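import Summits.CriticalPhenomena.PercolationContinuityZ3.Theorems.PercNearOneGluingNoHeavyQuantGatedBlobHull
import HarnessLib

/-!
# QUANT lane R8, T-DEC: CATERPILLAR LAWS AND THE GATED CATERPILLAR HULL — `LawDec.CatBuilt x M μ` (laws built from `δ₀` by blob
# slices, gates and floor-lowering: the count laws of rooted caterpillars), `sdec_of_catBuilt` (every caterpillar law is SDEC at its
# floor, NO hypothesis), the hull `LawDec.InGatedCatHull y T M μ` of gated caterpillar columns of a common mean, its DEC / SDEC
# consequences and the per-outer-gate residual API (census-2 g74 FREEHULL-G74 §0 (4) / §1, typed)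

builds on p205010 (kernel theorem, internal audit signed; external expert review pending)

Support + definition file (`--supports stmt-CriticalPhenomena-4575`), QUANT lane typer seat prim-quant-stmt (gen 41), rung R8 of
`run/shared/lean/prim/quant/LADDER.md`.  One inductive predicate (`CatBuilt`) and one `Prop` definition (`InGatedCatHull`); theorems with
standard axioms, no sorries.  Extends census-1 g23's `…QuantGatedBlobHull` (`InGatedBlobHull`, `decAtT_of_inGatedBlobHull`,
`decAt_gate_of_gatedBlobResidual`) from gated BLOB forests to gated CATERPILLARS, using typer g40's `sdec_slice'` (the blob slice, CW fed in,
unconditional), `sdec_gate` / `sdec_mono` (…QuantSDEC) and typer g35's `decAtT_gate_of_gatedSDEC` (…QuantGatedProductHull).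

WHY (census-2 g74, memo `run/shared/lean/prim/quant/prim-quant-census-2-g74/FREEHULL-G74.md`, confirmed by an independent engine of
census-1 g23, `…/prim-quant-census-1/TOPEXP-G23.md`).  The V428/V429 programme certifies the sibling step at an outer gate `a < 1` by hull
membership of the gated forest `gate_a(F)` (claim (I)) or of the top-level residual `R_a` (claim (II), arm-1 g48's `resid`).  The exact census
finds: on all 15 instances the lead asked about and all 18 outer gates, `R_a` lies in the pure GATED BLOB hull and `gate_a(F)` lies in the FREE
hull of gated blob forests ∪ GATED CATERPILLARS (540/540, exact rational certificates; kit j247891); the census-2 witness `(R¹[19/20](R²[1/2]))³`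
is ITSELF an 8-column mixture of 2 gated blob forests + 6 gated caterpillars of its own mean (certs/FH-witness-R1_95-R2_5-cubed-a1.json) — hence
SDEC with no oracle.  A CATERPILLAR law is built from the tip `δ₀` by hanging independent heavy blobs beside the spine (`slice μ a g`, gate
`g ≥` the floor; `g = 1`, `a = c`: `c` sure relays) and gating the spine vertex (`gate μ q`, floor `↦ q·floor`); by `sdec_slice'` and
`sdec_gate` every caterpillar law is SDEC at its floor — the "≤ 30-line induction `sdec_of_catBuilt`" census-2 g74 §1 names as the only
missing kernel item.  This file supplies it and the hull API; nothing here is a conjecture: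
* `CatBuilt x M μ` (constructors `nil`, `slice`, `gate`, `mono`); `CatBuilt.floor`, `CatBuilt.lawFacts` (nonnegative, vanishing above `M`,
  mass `1`, top-affordable `x·M ≤ mean`), **`sdec_of_catBuilt`**, `catBuilt_blobLaw` (blob lists are caterpillars);
* `InGatedCatHull y T M μ`: `μ = Σᵢ wᵢ · gate Pᵢ sᵢ`, `w ≥ 0`, `Σ w = 1`, `y < sᵢ ≤ 1`, `CatBuilt (y/sᵢ) Nᵢ Pᵢ`, `Nᵢ ≤ M`, `sᵢ · mean Pᵢ = T`;
  `InGatedCatHull.lawFacts`, `inGatedCatHull_gate_catBuilt` (one column), `inGatedCatHull_of_catBuilt` (`s = 1`), `InGatedCatHull.mix`,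
  `inGatedCatHull_gate` (stable under a further outer gate), **`inGatedCatHull_of_inGatedBlobHull`** / `inGatedCatHull_of_inBlobHull`
  (census-1's and typer g40's hulls are sub-hulls);
* **`decAtT_of_inGatedCatHull`** (a member is DEC at `(y, T)`, top `M`, EVERY layer), `decAt_of_inGatedCatHull`, **`sdec_of_inGatedCatHull`**;
* the residual API **`decAt_gate_of_gatedCatResidual`** (`gate F a = w·P + (1−w)·R`, `P` DEC at the target, `R` in the gated caterpillar hull
  ⟹ `gate F a` DEC at `(y, every layer)`), `decAtT_of_gatedCatResidual`, `decAt_of_gatedCatResidual`.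
The bridge to arm-1 g48's list-binder residual `resid a w L`, the per-gate targets (I)/(II) and the net node are the sequel `…QuantCatHullStep`.

HONEST STATUS: certificate-family infrastructure; `SiblingStep`, `GateStepN`, `FarTreeRow` OPEN; the census statements ('`R_a` in the gated
blob hull', '`gate_a F` in the free hull') are EVIDENCE (exact instances), not theorems.  Known free-vocabulary FAILURE at `a = 1`: the gapped
heavy family `(R¹[q](R³[3/5]))³`, `q ∈ {.9,.95,.97}` (FREEHULL-G74 §0 (3); bounded caterpillar depth).  RATE class log\* / honest sentence of
`run/shared/lean/prim/quant/README.md` unchanged.  [this work]; caterpillar hull: prim-quant-census-2 g74; gated blob hull: prim-quant-census-1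
g23; `sdec_slice'`/`InBlobHull`: prim-quant-stmt g40; programme (I)/(II): prim-quant-lead g46.  Nothing here is cited as a published result.
The gluing rows served [cite: KozmaNitzan2024, Conjecture 3 (p. 15)]; product measure [cite: Grimmett1999, §1.3 p. 10].
-/

noncomputable section

open scoped BigOperators

namespace Summit.CriticalPhenomena.PercolationContinuityZ3.Theorems
namespace Quant
namespace LawDec

open Finset

/-! ### Caterpillar laws -/

/-- **CATERPILLAR LAWS at floor `x`** — the closure of the tip `δ₀` (at any floor `0 < x < 1`) under (i) the BLOB SLICE `slice μ a g` (an
independent heavy blob of `a` relays with gate `x ≤ g ≤ 1` hung beside; `g = 1`: `a` sure relays), (ii) GATING `gate μ q`, `0 < q ≤ 1`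
(floor `↦ q·x`), (iii) lowering the floor.  These are the reached-relay count laws of rooted caterpillars (every non-leaf vertex on one root
path) with the least relay marginal as floor; gated blob forests are the depth-one case. [this work] -/
inductive CatBuilt : ℝ → ℕ → (ℕ → ℝ) → Prop
  | nil (x : ℝ) (hx0 : 0 < x) (hx1 : x < 1) : CatBuilt x 0 (fun h => if h = 0 then (1 : ℝ) else 0)
  | slice {x : ℝ} {M : ℕ} {μ : ℕ → ℝ} (h : CatBuilt x M μ) (a : ℕ) (g : ℝ) (hxg : x ≤ g) (hg1 : g ≤ 1) :
      CatBuilt x (M + a) (slice μ a g)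
  | gate {x : ℝ} {M : ℕ} {μ : ℕ → ℝ} (h : CatBuilt x M μ) (q : ℝ) (hq0 : 0 < q) (hq1 : q ≤ 1) :
      CatBuilt (q * x) M (gate μ q)
  | mono {x x' : ℝ} {M : ℕ} {μ : ℕ → ℝ} (h : CatBuilt x M μ) (hx'0 : 0 < x') (hxx : x' ≤ x) : CatBuilt x' M μ

/-- the floor of a caterpillar law lies in `(0,1)`. [this work] -/
theorem CatBuilt.floor {x : ℝ} {M : ℕ} {μ : ℕ → ℝ} (h : CatBuilt x M μ) : 0 < x ∧ x < 1 := by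
  induction h with
  | nil x₀ hx0 hx1 => exact ⟨hx0, hx1⟩
  | slice _ _ _ _ _ ih => exact ih
  | gate _ q hq0 hq1 ih => exact ⟨mul_pos hq0 ih.1, lt_of_le_of_lt (mul_le_of_le_one_left ih.1.le hq1) ih.2⟩
  | mono _ hx'0 hxx ih => exact ⟨hx'0, lt_of_le_of_lt hxx ih.2⟩

/-- **law facts of a caterpillar law**: nonnegative, vanishing above the top `M`, mass `1`, and top-affordable (`x·M ≤ mean`). [this work] -/
theorem CatBuilt.lawFacts {x : ℝ} {M : ℕ} {μ : ℕ → ℝ} (h : CatBuilt x M μ) :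
    (∀ k, 0 ≤ μ k) ∧ (∀ k, M < k → μ k = 0) ∧ (∑ k ∈ Finset.range (M + 1), μ k = 1) ∧
      x * (M : ℝ) ≤ ∑ k ∈ Finset.range (M + 1), (k : ℝ) * μ k := by
  induction h with
  | nil x₀ hx0 hx1 =>
    refine ⟨fun k => ?_, fun k hk => ?_, by simp, by simp⟩
    · show 0 ≤ (if k = 0 then (1 : ℝ) else 0)
      split_ifs <;> norm_num
    · show (if k = 0 then (1 : ℝ) else 0) = 0
      exact if_neg (by omega)
  | @slice x₀ M₀ μ₀ h₀ a g hxg hg1 ih =>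
    obtain ⟨f0, fM, f1, fta⟩ := ih
    have hx0 : 0 < x₀ := h₀.floor.1
    refine ⟨slice_nonneg μ₀ a g (hx0.le.trans hxg) hg1 f0, slice_eq_zero μ₀ a g M₀ fM, sum_slice μ₀ a g M₀ fM f1, ?_⟩
    rw [sum_mul_slice μ₀ a g M₀ fM f1]
    push_cast
    nlinarith [mul_le_mul_of_nonneg_right hxg (Nat.cast_nonneg a)]
  | @gate x₀ M₀ μ₀ _ q hq0 hq1 ih =>
    obtain ⟨f0, fM, f1, fta⟩ := ih
    obtain ⟨g0, gM, g1⟩ := gate_laws M₀ μ₀ q hq0.le hq1 f0 fM f1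
    refine ⟨g0, gM, g1, ?_⟩
    rw [sum_mul_gate, mul_assoc]
    exact mul_le_mul_of_nonneg_left fta hq0.le
  | mono _ _ hxx ih =>
    obtain ⟨f0, fM, f1, fta⟩ := ih
    exact ⟨f0, fM, f1, (mul_le_mul_of_nonneg_right hxx (Nat.cast_nonneg _)).trans fta⟩

/-- **EVERY CATERPILLAR LAW IS SDEC AT ITS FLOOR** — no hypothesis: the tip is vacuously SDEC, a blob slice keeps SDEC (`sdec_slice'`,
the blob gate step CW `gatedSliceMixLaw'_holds` fed in), a gate keeps SDEC (`sdec_gate`), lowering the floor keeps SDEC (`sdec_mono`).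
This is the kernel item `sdec_of_catBuilt` named by census-2 g74 (FREEHULL-G74 §1). [this work] -/
theorem sdec_of_catBuilt {x : ℝ} {M : ℕ} {μ : ℕ → ℝ} (h : CatBuilt x M μ) : SDEC x M μ := by
  induction h with
  | nil x₀ hx0 hx1 => intro q _ _ j' hj; exact absurd hj (Nat.not_lt_zero _)
  | @slice x₀ M₀ μ₀ h₀ a g hxg hg1 ih =>
    obtain ⟨f0, fM, f1, fta⟩ := h₀.lawFacts
    exact sdec_slice' x₀ g M₀ a μ₀ h₀.floor.1 h₀.floor.2 hxg hg1 f0 fM f1 fta ih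
  | gate _ q hq0 hq1 ih => exact sdec_gate ih q hq0 hq1
  | mono h₀ _ hxx ih => exact sdec_mono ih hxx h₀.floor.2

/-- **blob lists are caterpillars**: `blobLaw l` (gates in `[x, 1]`) is `CatBuilt x (blobTop l)` — successive slices of the tip. [this work] -/
theorem catBuilt_blobLaw (x : ℝ) (hx0 : 0 < x) (hx1 : x < 1) :
    ∀ l : List (ℕ × ℝ), (∀ p ∈ l, x ≤ p.2 ∧ p.2 ≤ 1) → CatBuilt x (blobTop l) (blobLaw l)
  | [], _ => CatBuilt.nil x hx0 hx1
  | p :: l, hl =>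
    CatBuilt.slice (catBuilt_blobLaw x hx0 hx1 l fun p' hp' => hl p' (List.mem_cons_of_mem p hp')) p.1 p.2
      (hl p List.mem_cons_self).1 (hl p List.mem_cons_self).2

/-- a sure block `δ_K` (`K` sure relays) is a caterpillar at every floor: the slice of the tip by `(K, 1)`. [this work] -/
theorem catBuilt_point (K : ℕ) (x : ℝ) (hx0 : 0 < x) (hx1 : x < 1) : CatBuilt x K (blobLaw [(K, 1)]) := by
  have := catBuilt_blobLaw x hx0 hx1 [(K, 1)] (fun p hp => by
    rw [List.mem_singleton] at hp; subst hp; exact ⟨hx1.le, le_rfl⟩)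
  simpa [blobTop] using this

/-! ### The gated caterpillar hull -/

/-- **Membership in the GATED CATERPILLAR HULL at floor `y`, target mean `T`, top `M`** (census-2 g74's free hull, typed): `μ` on `{0..M}`
is a finite mixture `μ = Σᵢ wᵢ · gate Pᵢ sᵢ` of GATED CATERPILLAR laws — outer gates `y < sᵢ ≤ 1`, `Pᵢ` a caterpillar law at floor `y/sᵢ`
with top `Nᵢ ≤ M` (so every relay marginal of the column is `≥ y`), and every column of mean EXACTLY `T` (`sᵢ · mean Pᵢ = T`). [this work] -/
def InGatedCatHull (y T : ℝ) (M : ℕ) (μ : ℕ → ℝ) : Prop :=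
  ∃ (ι : Type) (_ : Fintype ι) (w s : ι → ℝ) (N : ι → ℕ) (P : ι → ℕ → ℝ),
    (∀ i, 0 ≤ w i) ∧ ∑ i, w i = 1 ∧ (∀ i, y < s i ∧ s i ≤ 1) ∧ (∀ i, CatBuilt (y / s i) (N i) (P i)) ∧
    (∀ i, N i ≤ M) ∧ (∀ i, s i * ∑ h ∈ Finset.range (N i + 1), (h : ℝ) * P i h = T) ∧
    ∀ h, μ h = ∑ i, w i * gate (P i) (s i) h

/-- a sum over `range (M + 1)` of a function vanishing above `N ≤ M` is the sum over `range (N + 1)`. [folklore] -/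
private theorem sum_range_of_top_le (u : ℕ → ℝ) {N M : ℕ} (hNM : N ≤ M) (hu : ∀ h, N < h → u h = 0) :
    ∑ h ∈ Finset.range (M + 1), u h = ∑ h ∈ Finset.range (N + 1), u h := by
  obtain ⟨a, rfl⟩ := Nat.exists_eq_add_of_le hNM
  exact sum_range_extend u N a hu

/-- **law facts of a gated-caterpillar-hull member** (`0 ≤ y`): nonnegative, vanishing above `M`, mass `1`, mean `T`. [this work] -/
theorem InGatedCatHull.lawFacts {y T : ℝ} {M : ℕ} {μ : ℕ → ℝ} (h : InGatedCatHull y T M μ) (hy : 0 ≤ y) :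
    (∀ k, 0 ≤ μ k) ∧ (∀ k, M < k → μ k = 0) ∧ ∑ k ∈ Finset.range (M + 1), μ k = 1 ∧
      ∑ k ∈ Finset.range (M + 1), (k : ℝ) * μ k = T := by
  obtain ⟨ι, hι, w, s, N, P, hw0, hw1, hs, hC, hNM, hmean, hmix⟩ := h
  have hs0 : ∀ i, 0 ≤ s i := fun i => hy.trans (hs i).1.le
  have G : ∀ i, (∀ k, 0 ≤ gate (P i) (s i) k) ∧ (∀ k, N i < k → gate (P i) (s i) k = 0) ∧
      ∑ k ∈ Finset.range (N i + 1), gate (P i) (s i) k = 1 := fun i =>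
    gate_laws (N i) (P i) (s i) (hs0 i) (hs i).2 (hC i).lawFacts.1 (hC i).lawFacts.2.1 (hC i).lawFacts.2.2.1
  have GM : ∀ i k, M < k → gate (P i) (s i) k = 0 := fun i k hk => (G i).2.1 k (lt_of_le_of_lt (hNM i) hk)
  refine ⟨fun k => ?_, fun k hk => ?_, ?_, ?_⟩
  · rw [hmix k]; exact Finset.sum_nonneg fun i _ => mul_nonneg (hw0 i) ((G i).1 k)
  · rw [hmix k]; exact Finset.sum_eq_zero fun i _ => by rw [GM i k hk, mul_zero]
  · simp_rw [hmix]
    rw [Finset.sum_comm]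
    have e : ∀ i, ∑ k ∈ Finset.range (M + 1), w i * gate (P i) (s i) k = w i := fun i => by
      rw [← Finset.mul_sum, sum_range_of_top_le _ (hNM i) (G i).2.1, (G i).2.2, mul_one]
    simp_rw [e]; exact hw1
  · have e0 : ∀ k : ℕ, (k : ℝ) * μ k = ∑ i, w i * ((k : ℝ) * gate (P i) (s i) k) := fun k => by
      rw [hmix k, Finset.mul_sum]; exact Finset.sum_congr rfl fun i _ => by ring
    simp_rw [e0]
    rw [Finset.sum_comm]
    have e : ∀ i, ∑ k ∈ Finset.range (M + 1), w i * ((k : ℝ) * gate (P i) (s i) k) = w i * T := fun i => by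
      rw [← Finset.mul_sum, sum_range_of_top_le (fun k => (k : ℝ) * gate (P i) (s i) k) (hNM i)
        (fun k hk => by rw [(G i).2.1 k hk, mul_zero]), sum_mul_gate, hmean i]
    simp_rw [e]
    rw [← Finset.sum_mul, hw1, one_mul]

/-- **a single gated caterpillar column lies in the hull.** [this work] -/
theorem inGatedCatHull_gate_catBuilt (y s : ℝ) (hs : y < s ∧ s ≤ 1) {N : ℕ} {P : ℕ → ℝ} (hP : CatBuilt (y / s) N P)
    {M : ℕ} (hNM : N ≤ M) : InGatedCatHull y (s * ∑ h ∈ Finset.range (N + 1), (h : ℝ) * P h) M (gate P s) :=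
  ⟨Unit, inferInstance, fun _ => 1, fun _ => s, fun _ => N, fun _ => P, fun _ => zero_le_one, by simp, fun _ => hs, fun _ => hP,
    fun _ => hNM, fun _ => rfl, fun h => by simp⟩

/-- **an (ungated) caterpillar law lies in the hull at its own floor and mean** (`s = 1`). [this work] -/
theorem inGatedCatHull_of_catBuilt {x : ℝ} {M : ℕ} {μ : ℕ → ℝ} (h : CatBuilt x M μ) :
    InGatedCatHull x (∑ h ∈ Finset.range (M + 1), (h : ℝ) * μ h) M μ := by
  have key := inGatedCatHull_gate_catBuilt x 1 ⟨h.floor.2, le_rfl⟩ (N := M) (P := μ) (by rw [div_one]; exact h) le_rfl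
  rw [one_mul, gate_one] at key
  exact key

/-- **convexity** of the gated caterpillar hull. [this work] -/
theorem InGatedCatHull.mix {y T t : ℝ} {M : ℕ} {μ ν : ℕ → ℝ} (hμ : InGatedCatHull y T M μ) (hν : InGatedCatHull y T M ν)
    (ht0 : 0 ≤ t) (ht1 : t ≤ 1) : InGatedCatHull y T M (fun h => t * μ h + (1 - t) * ν h) := by
  obtain ⟨ι₁, hι₁, w₁, s₁, N₁, P₁, hw0₁, hw1₁, hs₁, hC₁, hN₁, hmean₁, hmix₁⟩ := hμ
  obtain ⟨ι₂, hι₂, w₂, s₂, N₂, P₂, hw0₂, hw1₂, hs₂, hC₂, hN₂, hmean₂, hmix₂⟩ := hν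
  refine ⟨ι₁ ⊕ ι₂, inferInstance, Sum.elim (fun i => t * w₁ i) (fun j => (1 - t) * w₂ j), Sum.elim s₁ s₂, Sum.elim N₁ N₂,
    Sum.elim P₁ P₂, ?_, ?_, ?_, ?_, ?_, ?_, fun h => ?_⟩
  · rintro (i | j)
    · exact mul_nonneg ht0 (hw0₁ i)
    · exact mul_nonneg (by linarith) (hw0₂ j)
  · rw [Fintype.sum_sum_type]
    simp only [Sum.elim_inl, Sum.elim_inr]
    rw [← Finset.mul_sum, ← Finset.mul_sum, hw1₁, hw1₂]; ring
  · rintro (i | j)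
    · exact hs₁ i
    · exact hs₂ j
  · rintro (i | j)
    · exact hC₁ i
    · exact hC₂ j
  · rintro (i | j)
    · exact hN₁ i
    · exact hN₂ j
  · rintro (i | j)
    · exact hmean₁ i
    · exact hmean₂ j
  · rw [Fintype.sum_sum_type]
    simp only [Sum.elim_inl, Sum.elim_inr]
    rw [hmix₁ h, hmix₂ h, Finset.mul_sum, Finset.mul_sum]
    refine congrArg₂ (· + ·) (Finset.sum_congr rfl fun i _ => by ring) (Finset.sum_congr rfl fun j _ => by ring)

/-- **the gated caterpillar hull is stable under a further outer gate** `0 < q ≤ 1`: floor and target scale by `q`, the columns keep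
their caterpillars (`(q·y)/(q·sᵢ) = y/sᵢ`) and their outer gates become `q·sᵢ` (`gate_gate`, `gate_mixture`). [this work] -/
theorem inGatedCatHull_gate {y T : ℝ} {M : ℕ} {μ : ℕ → ℝ} (h : InGatedCatHull y T M μ) (hy : 0 ≤ y) (q : ℝ) (hq0 : 0 < q)
    (hq1 : q ≤ 1) : InGatedCatHull (q * y) (q * T) M (gate μ q) := by
  obtain ⟨ι, hι, w, s, N, P, hw0, hw1, hs, hC, hNM, hmean, hmix⟩ := h
  refine ⟨ι, hι, w, fun i => q * s i, N, P, hw0, hw1, fun i => ⟨?_, ?_⟩, fun i => ?_, hNM, fun i => ?_, fun k => ?_⟩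
  · exact mul_lt_mul_of_pos_left (hs i).1 hq0
  · have hs0 : 0 ≤ s i := hy.trans (hs i).1.le
    nlinarith [(hs i).2, hs0]
  · have hs0 : 0 < s i := lt_of_le_of_lt hy (hs i).1
    rw [mul_div_mul_left y (s i) hq0.ne']
    exact hC i
  · rw [mul_assoc, hmean i]
  · rw [gate_mixture w (fun i => gate (P i) (s i)) q hw1 μ hmix k]
    exact Finset.sum_congr rfl fun i _ => by rw [gate_gate]

/-- **THE GATED BLOB HULL LIES IN THE GATED CATERPILLAR HULL** (`0 < y`; blob lists are caterpillars, `catBuilt_blobLaw`). [this work] -/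
theorem inGatedCatHull_of_inGatedBlobHull {y T : ℝ} {M : ℕ} {μ : ℕ → ℝ} (h : InGatedBlobHull y T M μ) (hy : 0 < y) :
    InGatedCatHull y T M μ := by
  obtain ⟨ι, hι, w, s, l, hw0, hw1, hs, hg, htop, hmean, hmix⟩ := h
  refine ⟨ι, hι, w, s, fun i => blobTop (l i), fun i => blobLaw (l i), hw0, hw1, hs, fun i => ?_, htop, fun i => ?_, hmix⟩
  · have hs0 : 0 < s i := hy.trans (hs i).1
    exact catBuilt_blobLaw (y / s i) (div_pos hy hs0) (by rw [div_lt_one hs0]; exact (hs i).1) (l i)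
      (InGatedBlobHull.gates_div (hs i).1 hy.le (hg i))
  · rw [sum_mul_blobLaw]; exact hmean i

/-- **THE (UNGATED) BLOB HULL LIES IN THE GATED CATERPILLAR HULL** (floor `0 < x < 1`). [this work] -/
theorem inGatedCatHull_of_inBlobHull {x m : ℝ} {M : ℕ} {μ : ℕ → ℝ} (h : InBlobHull x m M μ) (hx0 : 0 < x) (hx1 : x < 1) :
    InGatedCatHull x m M μ :=
  inGatedCatHull_of_inGatedBlobHull (inGatedBlobHull_of_inBlobHull h hx1) hx0

/-! ### DEC and SDEC consequences -/

/-- **A MEMBER OF THE GATED CATERPILLAR HULL IS DEC AT ITS FLOOR AND TARGET, AT EVERY LAYER**: each column `gate Pᵢ sᵢ` is the gate by `sᵢ`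
of a caterpillar law that is SDEC (`sdec_of_catBuilt`) and top-affordable at floor `y/sᵢ`, hence DEC at `(y, sᵢ·mean Pᵢ = T, j, M)` for every
`j` (`decAtT_gate_of_gatedSDEC` with the trivial further gate `1`); mixtures at a common target are DEC (`decAtT_finite_mixture`). [this work] -/
theorem decAtT_of_inGatedCatHull {y T : ℝ} {M : ℕ} {μ : ℕ → ℝ} (hy0 : 0 < y) (h : InGatedCatHull y T M μ) (j : ℕ) :
    DECAtT y T j M μ := by
  obtain ⟨ι, hι, w, s, N, P, hw0, hw1, hs, hC, hNM, hmean, hmix⟩ := h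
  refine decAtT_finite_mixture y T j M μ w (fun i => gate (P i) (s i)) hw0 hw1 hmix fun i _ => ?_
  obtain ⟨P0, PN, P1, Pta⟩ := (hC i).lawFacts
  have key := decAtT_gate_of_gatedSDEC y (s i) (N i) M (P i) hy0 (hs i).1 (hs i).2 P0 PN P1 Pta (sdec_of_catBuilt (hC i))
    (hNM i) 1 one_pos le_rfl j
  rw [one_mul, one_mul, hmean i, gate_one] at key
  exact key

/-- **A MEMBER OF THE GATED CATERPILLAR HULL (at its own mean) IS DEC(j) AT FLOOR `y` FOR EVERY LAYER `j`.** [this work] -/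
theorem decAt_of_inGatedCatHull {y T : ℝ} {M : ℕ} {μ : ℕ → ℝ} (hy0 : 0 < y) (h : InGatedCatHull y T M μ) (j : ℕ) :
    DECAt y j M μ := by
  rw [decAt_iff_decAtT, (h.lawFacts hy0.le).2.2.2]
  exact decAtT_of_inGatedCatHull hy0 h j

/-- **A MEMBER OF THE GATED CATERPILLAR HULL AT FLOOR `0 < x` IS SDEC AT `x`** (the hull is gate-stable, `inGatedCatHull_gate`) — census-2
g74's "a = 1 membership gives every outer gate". [this work] -/
theorem sdec_of_inGatedCatHull {x T : ℝ} {M : ℕ} {μ : ℕ → ℝ} (hx0 : 0 < x) (h : InGatedCatHull x T M μ) : SDEC x M μ := by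
  intro q hq0 hq1 j _
  exact decAt_of_inGatedCatHull (mul_pos hq0 hx0) (inGatedCatHull_gate h hx0.le q hq0 hq1) j

/-! ### The per-outer-gate residual API (caterpillar form) -/

/-- **THE RESIDUAL API (target form, caterpillar hull).**  If `G = w·P + (1 − w)·R` pointwise with `0 ≤ w ≤ 1`, `P` DEC at `(y, T, j, M)` and
`InGatedCatHull y T M R` (`0 < y`), then `G` is DEC at `(y, T, j, M)`. [this work] -/
theorem decAtT_of_gatedCatResidual {y T w : ℝ} {j M : ℕ} {G P R : ℕ → ℝ} (hy0 : 0 < y) (hw0 : 0 ≤ w) (hw1 : w ≤ 1)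
    (hP : DECAtT y T j M P) (hR : InGatedCatHull y T M R) (hid : ∀ h, G h = w * P h + (1 - w) * R h) :
    DECAtT y T j M G := by
  have e : G = fun h => w * P h + (1 - w) * R h := funext hid
  rw [e]
  exact decAtT_mixture w hw0 hw1 hP (decAtT_of_inGatedCatHull hy0 hR j)

/-- **THE RESIDUAL API (law form, caterpillar hull)**: as `decAtT_of_gatedCatResidual`, concluding `DECAt y j M G` when `T` is the mean of `G`.
[this work] -/
theorem decAt_of_gatedCatResidual {y T w : ℝ} {j M : ℕ} {G P R : ℕ → ℝ} (hy0 : 0 < y) (hw0 : 0 ≤ w) (hw1 : w ≤ 1)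
    (hP : DECAtT y T j M P) (hR : InGatedCatHull y T M R) (hid : ∀ h, G h = w * P h + (1 - w) * R h)
    (hT : ∑ h ∈ Finset.range (M + 1), (h : ℝ) * G h = T) : DECAt y j M G := by
  rw [decAt_iff_decAtT, hT]
  exact decAtT_of_gatedCatResidual hy0 hw0 hw1 hP hR hid

/-- **THE RESIDUAL API FOR A GATED LAW (caterpillar hull).**  For a law `F` on `{0..M}` of mean `m` and an outer gate `a`: if
`gate F a = w·P + (1−w)·R` pointwise with `0 ≤ w ≤ 1`, `P` DEC at `(y, a·m, j, M)` and `InGatedCatHull y (a·m) M R`, then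
`DECAt y j M (gate F a)`. [this work] -/
theorem decAt_gate_of_gatedCatResidual {y w a m : ℝ} {j M : ℕ} {F P R : ℕ → ℝ} (hy0 : 0 < y) (hw0 : 0 ≤ w) (hw1 : w ≤ 1)
    (hm : ∑ h ∈ Finset.range (M + 1), (h : ℝ) * F h = m)
    (hP : DECAtT y (a * m) j M P) (hR : InGatedCatHull y (a * m) M R) (hid : ∀ h, gate F a h = w * P h + (1 - w) * R h) :
    DECAt y j M (gate F a) :=
  decAt_of_gatedCatResidual hy0 hw0 hw1 hP hR hid (by rw [sum_mul_gate, hm])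

end LawDec
end Quant
end Summit.CriticalPhenomena.PercolationContinuityZ3.Theorems
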